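import Literature.NumberTheory.Automorphic.IdeleClassGaloisRepH2Cyclic
import Literature.Algebra.Homology.SecondInequalityQuotientLayer
import Mathlib.RepresentationTheory.Homological.GroupCohomology.Functoriality
import HarnessLib

/-!
# The second inequality in cohomological form: `#H²(Gal(E/F), C_E) ∣ [E : F]` for EVERY finite Galois
# extension of number fields (Tate, Cassels–Fröhlich Ch. VII §9 Thm. 9.1 (1); Neukirch, *Bonn Lectures* II §5
# Lemma (5.1) "purely cohomological" dévissage, fed with the cyclic norm index equality)

Topic `NumberTheory/Automorphic` (ideles, idele classes); namespace
`Literature.NumberTheory.Automorphic.IdeleClassGroup`.  Proof file: theorems only (no definition, no named fact,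
no instance; D-0026).  Sequel to `IdeleClassGaloisRep` (`galoisRep F E : Rep ℤ Gal(E/F)`, axiom I along every
injective `f : H →* Gal(E/F)`), `IdeleClassGaloisRepH2Cyclic` (`#H²(Gal(E/F), C_E) = [E:F]` for cyclic layers;
`N`-invariants = classes of `E^N`), assembled by the tree's abstract dévissage
`Algebra/Homology/SecondInequalityDevissage` (`SecondInequality.Hypotheses`, `natCard_H2_dvd_card`).

* §1 **`natCard_H2_quotientToInvariants_galoisRep`** — identification of a quotient layer: for `N ⊴ Gal(E/M)`
  with fixed field `L = E^N`, `H²(Gal(E/M) ⧸ N, (C_E)^N) ≅ H²(Gal(L/M), C_L)` (transport of structure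
  `groupCohomology.mapIso` along `Gal(E/M) ⧸ N ≅ Gal(L/M)` (`IsGalois.normalAutEquivQuotient`) and
  `(C_E)^N ≅ C_L` (Galois descent, `mem_invariants_res_galoisRep_iff`; equivariance
  `classGalAct_classBaseChange_tower`)); hence for `N` of prime index, `#H²(Gal(E/M) ⧸ N, (C_E)^N) = [L:M] = (Gal:N)`
  (`natCard_H2_galoisRep`, cyclic norm index).
* §2 the layer presented by an injective `f : H →* Gal(E/F)`: `Rep.res f (galoisRep F E)` is the layer `E / E^{f(H)}`
  (`natCard_H2_quotient_res_galoisRep_eq`, transport `LayerTransport`-style via `mapIso`).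
* §3 **`secondInequality_hypotheses`** — `SecondInequality.Hypotheses (galoisRep F E)`; hence
  **`natCard_H2_galoisRep_dvd_finrank`** — `#H²(Gal(E/F), C_E) ∣ [E : F]` and `finite_H2_galoisRep` — for every
  finite Galois extension of number fields (Neukirch II (5.1) / Tate 9.1 (1), the divisibility half of axiom II).

What is NOT here: the reverse divisibility / the fundamental class (`H²` cyclic of order exactly `[E:F]` with
invariant `1/[E:F]`), i.e. the rest of axiom II.

## References

* J. W. S. Cassels, A. Fröhlich (eds.), *Algebraic Number Theory* (1967), Ch. VII (J. Tate) §9 Thm. 9.1 and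
  its proof. [CasselsFrohlichANT1967]
* J. Neukirch, *Class Field Theory — The Bonn Lectures* (2013), Part II §5 Lemma (5.1); Part III §3.
  [Neukirch2013]
* J.-P. Serre, *Local Fields*, GTM 67 (1979), Ch. XI §1 (iv) (transport of structure), VII §6.
  [SerreLocalFields1979]
-/

noncomputable section

open NumberField CategoryTheory CategoryTheory.Limits groupCohomology
open scoped NumberField

namespace Literature.NumberTheory.Automorphic

namespace IdeleClassGroup

open Literature.NumberTheory.GaloisRepresentations Literature.Algebra.Homology

/-! ## §1. A quotient layer of `galoisRep M E` is the layer `E^N / M` -/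

section QuotientLayer

variable {M E : Type} [Field M] [Field E] [Algebra M E] [NumberField M] [NumberField E] [IsGalois M E]
  (N : Subgroup (E ≃ₐ[M] E)) [N.Normal]

/-- The descent identification `C_{E^N} ≅ (C_E)^N`, `a ↦ ι(a)`, onto the `N`-invariants of `galoisRep M E`, as a
`ℤ`-linear equivalence (injective: `classBaseChange_injective`; onto: Galois descent
`mem_invariants_res_galoisRep_iff`). [cite: CasselsFrohlichANT1967, Ch. VII §8 Prop. 8.1] -/
theorem exists_descentEquiv :
    ∃ φ : (galoisRep M (IntermediateField.fixedField N)).V ≃ₗ[ℤ]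
        ((galoisRep M E).quotientToInvariants N).V,
      ∀ a, ((φ a : ((galoisRep M E).quotientToInvariants N).V) : (galoisRep M E).V) =
        Additive.ofMul (classBaseChange (IntermediateField.fixedField N) E
          (Additive.toMul (α := IdeleClassGroup (IntermediateField.fixedField N)) a)) := by
  haveI : IsGalois (IntermediateField.fixedField N) E :=
    IsGalois.tower_top_of_isGalois M (IntermediateField.fixedField N) E
  set ι : IdeleClassGroup (IntermediateField.fixedField N) →* IdeleClassGroup E :=
    classBaseChange (IntermediateField.fixedField N) E with hι
  -- the underlying function and its additivity
  let t : (galoisRep M (IntermediateField.fixedField N)).V → ((galoisRep M E).quotientToInvariants N).V :=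
    fun a => ⟨Additive.ofMul (ι (Additive.toMul (α := IdeleClassGroup (IntermediateField.fixedField N)) a)),
      (mem_invariants_res_galoisRep_iff (F := M) N _).2
        ⟨Additive.toMul (α := IdeleClassGroup (IntermediateField.fixedField N)) a, rfl⟩⟩
  have ht : ∀ a, ((t a : ((galoisRep M E).quotientToInvariants N).V) : (galoisRep M E).V) =
      Additive.ofMul (ι (Additive.toMul (α := IdeleClassGroup (IntermediateField.fixedField N)) a)) := fun a => rfl
  have hadd : ∀ a b, t (a + b) = t a + t b := fun a b => Subtype.ext (by
    rw [ht]
    exact congrArg Additive.ofMul (map_mul ι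
      (Additive.toMul (α := IdeleClassGroup (IntermediateField.fixedField N)) a)
      (Additive.toMul (α := IdeleClassGroup (IntermediateField.fixedField N)) b)))
  let ψ : (galoisRep M (IntermediateField.fixedField N)).V →ₗ[ℤ] ((galoisRep M E).quotientToInvariants N).V :=
    AddMonoidHom.toIntLinearMap (AddMonoidHom.mk' t hadd)
  have hψ : ∀ a, ψ a = t a := fun a => rfl
  have hinj : Function.Injective ψ := fun a b hab => by
    have h : ι (Additive.toMul (α := IdeleClassGroup (IntermediateField.fixedField N)) a) =
        ι (Additive.toMul (α := IdeleClassGroup (IntermediateField.fixedField N)) b) :=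
      congrArg (fun x : ((galoisRep M E).quotientToInvariants N).V =>
        Additive.toMul (α := IdeleClassGroup E) (x : (galoisRep M E).V)) hab
    exact congrArg Additive.ofMul (classBaseChange_injective (IntermediateField.fixedField N) E h)
  have hsurj : Function.Surjective ψ := fun x => by
    obtain ⟨a, ha⟩ := (mem_invariants_res_galoisRep_iff (F := M) N (x : (galoisRep M E).V)).1 x.2
    exact ⟨Additive.ofMul a, Subtype.ext (by rw [hψ, ht]; exact congrArg Additive.ofMul ha)⟩
  exact ⟨LinearEquiv.ofBijective ψ ⟨hinj, hsurj⟩, fun a => ht a⟩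

/-- **`Hⁿ(Gal(E/M) ⧸ N, (C_E)^N) ≅ Hⁿ(Gal(E^N/M), C_{E^N})`** (transport of structure along
`Gal(E/M) ⧸ N ≅ Gal(E^N/M)` and the Galois descent `(C_E)^N = ι(C_{E^N})`): the quotient layer of the
representation `galoisRep M E` by a normal subgroup `N` is the Galois layer `E^N / M`; in particular the orders
of the cohomology groups agree. [cite: SerreLocalFields1979, Ch. XI §1 (iv)] -/
theorem natCard_groupCohomology_quotientToInvariants_galoisRep (n : ℕ) :
    Nat.card (groupCohomology ((galoisRep M E).quotientToInvariants N) n) =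
      Nat.card (groupCohomology (galoisRep M (IntermediateField.fixedField N)) n) := by
  haveI : IsGalois (IntermediateField.fixedField N) E :=
    IsGalois.tower_top_of_isGalois M (IntermediateField.fixedField N) E
  obtain ⟨φ, hφ⟩ := exists_descentEquiv (M := M) (E := E) N
  -- equivariance of `φ.symm` along `Gal(E/M) ⧸ N ≅ Gal(E^N/M)`
  have he : ∀ q : (E ≃ₐ[M] E) ⧸ N,
      φ.symm.toLinearMap ∘ₗ ((galoisRep M E).quotientToInvariants N).ρ q =
        (galoisRep M (IntermediateField.fixedField N)).ρ (IsGalois.normalAutEquivQuotient N q) ∘ₗ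
          φ.symm.toLinearMap := fun q => by
    induction q using QuotientGroup.induction_on with
    | H g =>
      refine LinearMap.ext fun x => ?_
      obtain ⟨a, rfl⟩ := φ.surjective x
      change φ.symm (((galoisRep M E).quotientToInvariants N).ρ (g : (E ≃ₐ[M] E) ⧸ N) (φ a)) =
        (galoisRep M (IntermediateField.fixedField N)).ρ (IsGalois.normalAutEquivQuotient N g) (φ.symm (φ a))
      have h1 : φ.symm (φ a) = a := φ.symm_apply_apply a
      rw [h1]
      apply φ.injective
      have h2 : φ (φ.symm (((galoisRep M E).quotientToInvariants N).ρ (g : (E ≃ₐ[M] E) ⧸ N) (φ a))) =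
          ((galoisRep M E).quotientToInvariants N).ρ (g : (E ≃ₐ[M] E) ⧸ N) (φ a) := φ.apply_symm_apply _
      rw [h2]
      apply Subtype.ext
      change (galoisRep M E).ρ g (φ a : (galoisRep M E).V) = _
      rw [hφ, hφ, galoisRep_ρ_apply, galoisRep_ρ_apply, toMul_ofMul, toMul_ofMul,
        IsGalois.normalAutEquivQuotient_apply]
      exact congrArg Additive.ofMul (classGalAct_classBaseChange_tower g _)
  exact Nat.card_congr
    (groupCohomology.mapIso (IsGalois.normalAutEquivQuotient N) φ.symm he n).toLinearEquiv.toEquiv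

/-- **`#H²(Gal(E/M) ⧸ N, (C_E)^N) = (Gal(E/M) : N)` for `N` of PRIME index** (the quotient layer `E^N/M` is
cyclic of prime degree `(G : N)`, so `#H²(Gal(E^N/M), C_{E^N}) = [E^N : M]` by the cyclic count
`natCard_H2_galoisRep`). [cite: Neukirch2013, Part II §5 Lemma (5.1) (cyclic prime layers)] -/
theorem natCard_H2_quotientToInvariants_galoisRep_of_prime (hp : N.index.Prime) :
    Nat.card (groupCohomology ((galoisRep M E).quotientToInvariants N) 2) = N.index := by
  haveI : Fact N.index.Prime := ⟨hp⟩
  have hcard : Nat.card ((IntermediateField.fixedField N) ≃ₐ[M] (IntermediateField.fixedField N)) =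
      N.index := by
    rw [← Nat.card_congr (IsGalois.normalAutEquivQuotient N).toEquiv, Subgroup.index_eq_card]
  haveI : IsCyclic ((IntermediateField.fixedField N) ≃ₐ[M] (IntermediateField.fixedField N)) :=
    isCyclic_of_prime_card (p := N.index) hcard
  rw [natCard_groupCohomology_quotientToInvariants_galoisRep N 2, natCard_H2_galoisRep,
    ← IsGalois.card_aut_eq_finrank, hcard]

end QuotientLayer

/-! ## §2. The layer presented by an injective `f : H →* Gal(E/F)` is the layer `E / E^{f(H)}` -/

section HomLayer

variable {F E : Type} [Field F] [Field E] [Algebra F E] [NumberField F] [NumberField E]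
  {H : Type} [Group H] (f : H →* (E ≃ₐ[F] E)) (hf : Function.Injective f)

include hf in
/-- **Transport of the layer `(H, Res_f C_E)` to the Galois layer `E / E^{f(H)}`**: along
`e : H ≃* f(H) ≃* Gal(E/E^{f(H)})` (`MonoidHom.ofInjective`, `IntermediateField.subgroupEquivAlgEquiv`) the
representation `Rep.res f (galoisRep F E)` is `galoisRep E^{f(H)} E` (same module `Additive C_E`, same action by
`classGalAct_restrictScalars`), so the quotient layers by `N ⊴ H` and by `e(N)` have cohomology of the same order
(`LayerTransport.natCard_quotient_congr`). [cite: SerreLocalFields1979, Ch. XI §1 (iv)] -/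
theorem natCard_quotient_res_galoisRep_eq (N : Subgroup H) [N.Normal] (n : ℕ) :
    haveI : (N.map ((MonoidHom.ofInjective hf).trans
        (IntermediateField.subgroupEquivAlgEquiv f.range)).toMonoidHom).Normal :=
      Subgroup.Normal.map inferInstance _ ((MonoidHom.ofInjective hf).trans
        (IntermediateField.subgroupEquivAlgEquiv f.range)).surjective
    Nat.card (groupCohomology ((Rep.res f (galoisRep F E)).quotientToInvariants N) n) =
      Nat.card (groupCohomology ((galoisRep (IntermediateField.fixedField f.range) E).quotientToInvariants
        (N.map ((MonoidHom.ofInjective hf).trans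
          (IntermediateField.subgroupEquivAlgEquiv f.range)).toMonoidHom)) n) := by
  set e := (MonoidHom.ofInjective hf).trans (IntermediateField.subgroupEquivAlgEquiv f.range) with hedef
  haveI hNn : (N.map e.toMonoidHom).Normal := Subgroup.Normal.map inferInstance _ e.surjective
  have he : ∀ g : H, (e g).restrictScalars F = f g := fun g => by
    rw [hedef, MulEquiv.trans_apply]
    exact AlgEquiv.ext fun _ => rfl
  refine LayerTransport.natCard_quotient_congr e (Rep.res f (galoisRep F E))
    (galoisRep (IntermediateField.fixedField f.range) E) (LinearEquiv.refl ℤ (galoisRep F E).V)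
    (fun g => LinearMap.ext fun x => ?_) N (N.map e.toMonoidHom) rfl n
  change (galoisRep F E).ρ (f g) x = (galoisRep (IntermediateField.fixedField f.range) E).ρ (e g) x
  rw [galoisRep_ρ_apply, galoisRep_ρ_apply, ← classGalAct_restrictScalars (F := F) (e g), he]

include hf in
/-- **The prime quotient layers of `(H, Res_f C_E)` have `#H² = (H : N)`**: for `N ⊴ H` of prime index,
`#H²(H ⧸ N, (Res_f C_E)^N) = (H : N)` (§1 for the layer `E^{e(N)} / E^{f(H)}`).
[cite: Neukirch2013, Part II §5 Lemma (5.1) (cyclic prime layers)] -/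
theorem natCard_H2_quotient_res_galoisRep_of_prime [IsGalois F E] (N : Subgroup H) [N.Normal]
    (hp : N.index.Prime) :
    Nat.card (groupCohomology ((Rep.res f (galoisRep F E)).quotientToInvariants N) 2) = N.index := by
  set e := (MonoidHom.ofInjective hf).trans (IntermediateField.subgroupEquivAlgEquiv f.range) with hedef
  haveI hNn : (N.map e.toMonoidHom).Normal := Subgroup.Normal.map inferInstance _ e.surjective
  haveI : IsGalois (IntermediateField.fixedField f.range) E :=
    IsGalois.tower_top_of_isGalois F (IntermediateField.fixedField f.range) E
  have hidx : (N.map e.toMonoidHom).index = N.index := Subgroup.index_map_equiv N e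
  rw [natCard_quotient_res_galoisRep_eq f hf N 2,
    natCard_H2_quotientToInvariants_galoisRep_of_prime (N.map e.toMonoidHom) (hidx.symm ▸ hp), hidx]

end HomLayer

/-! ## §3. The second inequality `#H²(Gal(E/F), C_E) ∣ [E : F]` -/

section SecondInequality

variable {F E : Type} [Field F] [Field E] [Algebra F E] [NumberField F] [NumberField E] [IsGalois F E]

/-- **The hypotheses of the tree's dévissage hold for `(Gal(E/F), C_E)`**: axiom I along every injective
`H →* Gal(E/F)` (`isZero_H1_res_hom_galoisRep`) and `#H² = p` on every cyclic quotient layer of prime order `p`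
(`natCard_H2_quotient_res_galoisRep_of_prime`). [cite: Neukirch2013, Part II §5 Lemma (5.1)] -/
theorem secondInequality_hypotheses : SecondInequality.Hypotheses (galoisRep F E) where
  isZero_H1 := fun _ _ _ f hf => isZero_H1_res_hom_galoisRep f hf
  natCard_H2_quotient_dvd := fun _ _ _ f hf N _ hp =>
    dvd_of_eq (natCard_H2_quotient_res_galoisRep_of_prime f hf N hp)

/-- **The second inequality in cohomological form: `#H²(Gal(E/F), C_E)` divides `[E : F]`** for every finite
Galois extension of number fields (Tate, Cassels–Fröhlich VII §9 Thm. 9.1 (1) "`#H²(G, C_L)` divides `n`";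
Neukirch II (5.1)), by the tree's dévissage `SecondInequality.natCard_H2_dvd_card` from the cyclic prime layers
(norm index equality) and axiom I. [cite: CasselsFrohlichANT1967, Ch. VII §9 Thm. 9.1 (1)] -/
theorem natCard_H2_galoisRep_dvd_finrank :
    Nat.card (groupCohomology (galoisRep F E) 2) ∣ Module.finrank F E := by
  rw [← IsGalois.card_aut_eq_finrank]
  exact SecondInequality.natCard_H2_dvd_card secondInequality_hypotheses

/-- `H²(Gal(E/F), C_E)` is finite. [cite: CasselsFrohlichANT1967, Ch. VII §9 Thm. 9.1] -/
theorem finite_H2_galoisRep : Finite (groupCohomology (galoisRep F E) 2) :=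
  SecondInequality.finite_H2 secondInequality_hypotheses

/-- **Along every injective `f : H →* Gal(E/F)`: `#H²(H, Res_f C_E) ∣ #H`** (the second inequality for every
layer `E / E^{f(H)}`). [cite: Neukirch2013, Part II §5 Lemma (5.1)] -/
theorem natCard_H2_res_galoisRep_dvd_card {H : Type} [Group H] [Finite H] (f : H →* (E ≃ₐ[F] E))
    (hf : Function.Injective f) : Nat.card (groupCohomology (Rep.res f (galoisRep F E)) 2) ∣ Nat.card H :=
  SecondInequality.natCard_H2_res_dvd_card secondInequality_hypotheses f hf

end SecondInequality

end IdeleClassGroup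

end Literature.NumberTheory.Automorphic

end
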